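import Summits.NavierStokesRegularity.NavierStokesRegularity.Theses.ForcedAmplifier
import Literature.Analysis.FunctionSpaces.TorusDiffMonomialBounds
import Literature.Analysis.FluidPDE.TorusClassicalLerayHopfProofs
import Literature.Analysis.FluidPDE.PassiveScalarVelocityStability
import HarnessLib

/-!
# The amplifier amplifies ENSTROPHY only — an energy ceiling along forced episodes (support of item
# stmt-NavierStokesRegularity-28101 `AMP`, route `ForcedAmplifier`, N31 «THE AMPLIFIER»)

ROOT DECOMPOSITION CELL decomp-ns, lens-4 (minimal-counterexample / extremal reduction), generation 26:
instrumenting the residual.  Definition-free; no `sorry`; standard axioms.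

## Content

* `energy_ceiling` — along a classical solution of the forced Navier–Stokes system on `[0,T] × 𝕋³`
  (`ν ≥ 0`) whose datum has `2·E(u(0)) ≤ A` and whose force has `2·E(f(t)) ≤ A` on `[0,T]`
  (`E = kineticEnergy = ½‖·‖²_{L²}`), the kinetic energy obeys `2·E(u(t)) ≤ A (1 + t)²`: the energy
  balance `d/dt E(u) = −ν‖∇u‖₂² + ∫⟪f, u⟫ ≤ ‖f‖₂ ‖u‖₂` (`Torus.IsClassicalNSSolutionOn.energy_balance_holds`,
  Cauchy–Schwarz `Torus.integral_mul_le_sqrt_mul_sqrt`) and the `√`-comparison lemma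
  `Torus.sqrt_le_sqrt_add_integral_of_hasDerivWithinAt` give `√E(u(t)) ≤ √E(u(0)) + t·√(A/2)`.
* `amp_iff_enstrophyAmplification` — consequently the residual `AMP` (unbounded forced `H¹`
  amplification at bounded `H¹` budget and bounded horizon) is EQUIVALENT to its enstrophy form: for
  every `ν > 0` there is a budget `(A, T₀)` such that for every `M` some episode within the budget has
  kinetic energy `≤ A (1 + T₀)²/2` throughout and ENSTROPHY `‖∇u(t)‖₂² > M` at some time.  The blow-up
  mechanism the residual asks for is unbounded vortex stretching at bounded energy, bounded `H¹` forcing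
  and bounded time — never an energy cascade upward in size.
[cite: DoeringFoias2002, §2 eq. (2.4) (energy balance); ConstantinFoias1988, Ch. 10 (enstrophy and the
continuation criterion); Tao2013Localisation, §1 (the `H¹` a-priori-bound formulation)]
-/

set_option linter.dupNamespace false

noncomputable section

open Set Function Filter MeasureTheory
open scoped ContDiff Topology InnerProductSpace
open Literature.Analysis.FunctionSpaces Literature.Analysis.FluidPDE

namespace Summit.NavierStokesRegularity.NavierStokesRegularity.Theorems.ForcedAmplifierEnergyCeiling

/-- Cauchy–Schwarz for the work term: `∫⟪f, u⟫ ≤ √(∫‖f‖²) · √(∫‖u‖²)`. [folklore] -/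
theorem integral_inner_le_sqrt_mul_sqrt {f u : UnitAddTorus (Fin 3) → EuclideanSpace ℝ (Fin 3)}
    (hf : Continuous f) (hu : Continuous u) :
    ∫ x, ⟪f x, u x⟫_ℝ ≤ Real.sqrt (∫ x, ‖f x‖ ^ 2) * Real.sqrt (∫ x, ‖u x‖ ^ 2) := by
  have h1 : ∫ x, ⟪f x, u x⟫_ℝ ≤ ∫ x, ‖f x‖ * ‖u x‖ :=
    integral_mono (hf.inner hu).integrable_unitAddTorus
      ((hf.norm.mul hu.norm).integrable_unitAddTorus) fun x => real_inner_le_norm _ _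
  exact h1.trans (Torus.integral_mul_le_sqrt_mul_sqrt hf.norm hu.norm)

/-- **Energy ceiling along a forced episode.** If `(u, p)` is a classical solution of the Navier–Stokes
system with viscosity `ν ≥ 0` and force `f` on `[0,T] × 𝕋³`, with `2·E(u(0)) ≤ A` and `2·E(f(s)) ≤ A`
for `s ∈ [0,T]`, then `2·E(u(t)) ≤ A (1 + t)²` for every `t ∈ [0,T]`.
[cite: DoeringFoias2002, §2 eq. (2.4)] -/
theorem energy_ceiling {ν T A : ℝ} (hν : 0 ≤ ν)
    {f u : ℝ → UnitAddTorus (Fin 3) → EuclideanSpace ℝ (Fin 3)} {p : ℝ → UnitAddTorus (Fin 3) → ℝ}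
    (h : Torus.IsClassicalNSSolutionOn (Icc 0 T) ν f u p)
    (hf : Torus.IsSmoothSpaceTimeOn (Icc 0 T) f)
    (h0 : 2 * Torus.kineticEnergy (u 0) ≤ A)
    (hfA : ∀ s ∈ Icc 0 T, 2 * Torus.kineticEnergy (f s) ≤ A) {t : ℝ} (ht : t ∈ Icc 0 T) :
    2 * Torus.kineticEnergy (u t) ≤ A * (1 + t) ^ 2 := by
  have hA0 : 0 ≤ A := by linarith [Torus.kineticEnergy_nonneg (u 0)]
  rcases eq_or_lt_of_le ht.1 with h00 | htpos
  · rw [← h00]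
    nlinarith
  have hconv : Convex ℝ (Icc 0 T) := convex_Icc 0 T
  have hUT : UniqueDiffOn ℝ (Icc 0 T) := uniqueDiffOn_Icc (htpos.trans_le ht.2)
  have hI : Icc 0 t ⊆ Icc 0 T := Icc_subset_Icc_right ht.2
  have hus := h.smooth_velocity
  set E : ℝ → ℝ := fun s => Torus.kineticEnergy (u s) with hE
  set D : ℝ → ℝ := fun s => -ν * Torus.gradNormSq (u s) + ∫ x, ⟪f s x, u s x⟫_ℝ with hD
  have hderiv : ∀ s ∈ Icc 0 t, HasDerivWithinAt E (D s) (Icc 0 t) s := fun s hs =>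
    (Torus.IsClassicalNSSolutionOn.energy_balance_holds h hconv (hI hs)).mono hI
  have hDc : ContinuousOn D (Icc 0 t) :=
    (((hus.continuousOn_gradNormSq hconv hUT).mono hI).const_smul (-ν)).add
      (((hf.inner hus).continuousOn_integral hconv).mono hI)
  set c : ℝ := Real.sqrt A * Real.sqrt 2 / 2 with hc
  have hc0 : 0 ≤ c := by positivity
  have hle : ∀ s ∈ Icc 0 t, D s ≤ 2 * Real.sqrt (E s) * c := by
    intro s hs
    have hs' : s ∈ Icc 0 T := hI hs
    have hfc : Continuous (f s) := (hf.isSmooth_slice hs').continuous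
    have huc : Continuous (u s) := (hus.isSmooth_slice hs').continuous
    have h1 := integral_inner_le_sqrt_mul_sqrt hfc huc
    have h2 : -ν * Torus.gradNormSq (u s) ≤ 0 := by
      have := Torus.gradNormSq_nonneg (u s)
      nlinarith
    have h3 : Real.sqrt (∫ x, ‖u s x‖ ^ 2) = Real.sqrt 2 * Real.sqrt (E s) := by
      have : (∫ x, ‖u s x‖ ^ 2) = 2 * E s := by
        simp only [hE, Torus.kineticEnergy]; ring
      rw [this, Real.sqrt_mul (by norm_num : (0:ℝ) ≤ 2)]
    have h4 : Real.sqrt (∫ x, ‖f s x‖ ^ 2) ≤ Real.sqrt A := by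
      refine Real.sqrt_le_sqrt ?_
      have : (∫ x, ‖f s x‖ ^ 2) = 2 * Torus.kineticEnergy (f s) := by
        simp only [Torus.kineticEnergy]; ring
      rw [this]
      exact hfA s hs'
    have h5 : Real.sqrt (∫ x, ‖f s x‖ ^ 2) * Real.sqrt (∫ x, ‖u s x‖ ^ 2) ≤
        Real.sqrt A * (Real.sqrt 2 * Real.sqrt (E s)) := by
      rw [← h3]
      exact mul_le_mul_of_nonneg_right h4 (Real.sqrt_nonneg _)
    calc D s ≤ Real.sqrt (∫ x, ‖f s x‖ ^ 2) * Real.sqrt (∫ x, ‖u s x‖ ^ 2) := by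
          simp only [hD]; linarith
      _ ≤ Real.sqrt A * (Real.sqrt 2 * Real.sqrt (E s)) := h5
      _ = 2 * Real.sqrt (E s) * c := by simp only [hc]; ring
  have hmain := Torus.sqrt_le_sqrt_add_integral_of_hasDerivWithinAt htpos.le hderiv hDc
    (fun s _ => Torus.kineticEnergy_nonneg _) hle (fun _ _ => hc0) intervalIntegrable_const
  rw [intervalIntegral.integral_const, smul_eq_mul, sub_zero] at hmain
  have hE0 : Real.sqrt (E 0) ≤ c := by
    have h6 : E 0 ≤ c ^ 2 := by
      have : c ^ 2 = A / 2 := by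
        simp only [hc]
        rw [div_pow, mul_pow, Real.sq_sqrt hA0, Real.sq_sqrt (by norm_num : (0:ℝ) ≤ 2)]
        ring
      rw [this]
      simp only [hE]
      linarith
    calc Real.sqrt (E 0) ≤ Real.sqrt (c ^ 2) := Real.sqrt_le_sqrt h6
      _ = c := Real.sqrt_sq hc0
  have hsq : Real.sqrt (E t) ≤ c * (1 + t) := by
    calc Real.sqrt (E t) ≤ Real.sqrt (E 0) + t * c := hmain
      _ ≤ c + t * c := by linarith
      _ = c * (1 + t) := by ring
  have hEt : E t = Real.sqrt (E t) ^ 2 := (Real.sq_sqrt (Torus.kineticEnergy_nonneg _)).symm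
  have h7 : Real.sqrt (E t) ^ 2 ≤ (c * (1 + t)) ^ 2 :=
    pow_le_pow_left₀ (Real.sqrt_nonneg _) hsq 2
  have hc2 : c ^ 2 = A / 2 := by
    simp only [hc]
    rw [div_pow, mul_pow, Real.sq_sqrt hA0, Real.sq_sqrt (by norm_num : (0:ℝ) ≤ 2)]
    ring
  calc 2 * Torus.kineticEnergy (u t) = 2 * Real.sqrt (E t) ^ 2 := by rw [← hEt]
    _ ≤ 2 * (c * (1 + t)) ^ 2 := by linarith
    _ = A * (1 + t) ^ 2 := by rw [mul_pow, hc2]; ring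

/-- **`AMP` is enstrophy amplification at bounded energy.**  The residual of route `ForcedAmplifier` is
equivalent to: for every `ν > 0` there is a budget `(A, T₀)` such that for every `M` some classical forced
episode on `[0,T] × 𝕋³`, `T ≤ T₀`, with `‖u(0)‖²_{H¹} ≤ A` and `‖f(t)‖²_{H¹} ≤ A`, has kinetic energy
`2·E(u(t)) ≤ A (1 + T₀)²` THROUGHOUT and enstrophy `‖∇u(t)‖₂² > M` at some time.
[cite: ConstantinFoias1988, Ch. 10; Tao2013Localisation, §1] -/
theorem amp_iff_enstrophyAmplification :
    Theses.ForcedAmplifier.AMP ↔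
      ∀ ν : ℝ, 0 < ν → ∃ A T₀ : ℝ, ∀ M : ℝ,
        ∃ (T : ℝ) (f u : ℝ → UnitAddTorus (Fin 3) → EuclideanSpace ℝ (Fin 3))
          (p : ℝ → UnitAddTorus (Fin 3) → ℝ),
          (0 < T ∧ Torus.IsClassicalNSSolutionOn (Icc 0 T) ν f u p ∧
              Torus.IsSmoothSpaceTimeOn (Icc 0 T) f) ∧
            T ≤ T₀ ∧ 2 * Torus.kineticEnergy (u 0) + Torus.gradNormSq (u 0) ≤ A ∧
            (∀ t ∈ Icc 0 T, 2 * Torus.kineticEnergy (f t) + Torus.gradNormSq (f t) ≤ A) ∧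
            (∀ t ∈ Icc 0 T, 2 * Torus.kineticEnergy (u t) ≤ A * (1 + T₀) ^ 2) ∧
            ∃ t ∈ Icc 0 T, M < Torus.gradNormSq (u t) := by
  constructor
  · intro hAMP ν hν
    obtain ⟨A, T₀, hM⟩ := hAMP ν hν
    refine ⟨A, T₀, fun M => ?_⟩
    obtain ⟨T, f, u, p, ⟨hT, hsol, hf⟩, hTT₀, h0, hfA, t, ht, hpeak⟩ := hM (M + A * (1 + T₀) ^ 2)
    have hceil : ∀ s ∈ Icc 0 T, 2 * Torus.kineticEnergy (u s) ≤ A * (1 + T₀) ^ 2 := by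
      intro s hs
      have hA0 : 0 ≤ A := by
        linarith [Torus.kineticEnergy_nonneg (u 0), Torus.gradNormSq_nonneg (u 0)]
      have h1 := energy_ceiling (A := A) hν.le hsol hf
        (by linarith [Torus.gradNormSq_nonneg (u 0)])
        (fun r hr => by linarith [hfA r hr, Torus.gradNormSq_nonneg (f r)]) hs
      have h2 : A * (1 + s) ^ 2 ≤ A * (1 + T₀) ^ 2 := by
        have hs1 : 0 ≤ 1 + s := by linarith [hs.1]
        have hs2 : 1 + s ≤ 1 + T₀ := by linarith [hs.2]
        exact mul_le_mul_of_nonneg_left (pow_le_pow_left₀ hs1 hs2 2) hA0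
      exact h1.trans h2
    refine ⟨T, f, u, p, ⟨hT, hsol, hf⟩, hTT₀, h0, hfA, hceil, t, ht, ?_⟩
    have := hceil t ht
    linarith
  · intro h ν hν
    obtain ⟨A, T₀, hM⟩ := h ν hν
    refine ⟨A, T₀, fun M => ?_⟩
    obtain ⟨T, f, u, p, hep, hTT₀, h0, hfA, -, t, ht, hpeak⟩ := hM M
    refine ⟨T, f, u, p, hep, hTT₀, h0, hfA, t, ht, ?_⟩
    linarith [Torus.kineticEnergy_nonneg (u t)]

end Summit.NavierStokesRegularity.NavierStokesRegularity.Theorems.ForcedAmplifierEnergyCeiling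

end
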